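import Mathlib
import HarnessLib
import Summits.HubbardSuperconductivity.HubbardSuperconductivity.Theorems.KLProgrammeSWaveCascadeVarying

/-!
# Route `KLProgramme` — the s-wave-dressed Cooper cascade with scale-dependent weights AND ENTRY-LOCALISED tails
# ((E2-v4) `PairLadderStepAtV4` at every step ⇒ (B1-v2) `PairArrayAt`; row 0′ of the K3 supplier map on the V4/V4S engine slot)

Cell gate-hubbard-kl, seat p3 (g4); refinement of `sWaveCascade_envelope_varying` (`KLProgrammeSWaveCascadeVarying.lean`, g3).
In the V4 engine slot (`KLProgrammeKLRegimeSplitEngineV4.lean`, p1) the one-scale ladder remainder `Δ_n(k,k')` carries, besides the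
entry-uniform part `a_n = drivePBar + ē + thermalBar` (summable in `n`), the LEG-DRESSING part `d_n(k,k') = legDressBar·legSliceCount`,
which is `O((Klam U)²)` at EVERY step at the entries whose legs cross slice `n` — in particular at all entries `(k,p)` with `p` the
step's loop momentum — and is summable in `n` only ENTRYWISE (`Σ_n d_n(k,k') ≤ δ = 20·CF·(Klam U)²` for each fixed `(k,k')`).  The
g3 envelope charges `Σ_n esup T_n` and would return a logarithm.  Here the tail of the implicit step is taken in its structured form
`T_n = Δ_n + Δ_n ∗_w 𝒞_n` and the same weight-independent decomposition `𝒟 = K + row + column + σ·J` is run with two changes: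
(i) the core `K` accumulates the direct tails ENTRYWISE (so `δ`, not `Σ_n max d_n`, enters), and (ii) the column-type injection
`U_n·(Δ_n ∗_w J)` (size `U_n W_n (a_n + d̄)` in every row) is absorbed by the CONVEX column recursion
`C'(1 + U W) = C − U·rowSum_w K' + U·(Δ ∗_w J)` — the one-sided contraction `U_{n+1}/U_n` of the repulsive cascade pays for it
(`Σ_n U_N W_n ≤ 1`), with no logarithm.  Result **`sWaveCascade_envelope_sector`**: for all `n ≤ N`,
`esup (𝒞_n − U_n J) ≤ 8·(esup (𝒞_0 − U_0 J) + δ + d̄ + 2·Σ_{j<N} a_j)` and `0 ≤ U_n ≤ U_0`, under the smallness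
`160·(esup 𝒟_0 + δ + d̄ + 2 Σ_j a_j)·Σ_j W_j ≤ 1`.  Everything is proved; no definitions.
References: HOME/STATUS 2026-08-26 p1 12:15:48Z (`EngineBoundsAtV4`), p1 12:50:02Z / 13:05:39Z (the entry-localised trap for child 1),
p3 g4 STARTED line (this remedy).
-/

noncomputable section

namespace Summit.HubbardSuperconductivity.HubbardSuperconductivity.Theorems.SWaveCascade

set_option linter.dupNamespace false -- summit = problem name (single-conjunct summit), D-0017

open Finset

variable {S : Type*} [Fintype S]

/-! ## §6a Entrywise bookkeeping -/

omit [Fintype S] in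
/-- An entry of a finite sum of arrays is bounded by the sum of the entry bounds. -/
theorem norm_sum_apply_le (E : ℕ → S → S → ℂ) (n : ℕ) (s t : S) {b : ℕ → ℝ} (hb : ∀ j < n, ‖E j s t‖ ≤ b j) :
    ‖(∑ j ∈ range n, E j) s t‖ ≤ ∑ j ∈ range n, b j := by
  rw [Finset.sum_apply, Finset.sum_apply]
  exact (norm_sum_le _ _).trans (sum_le_sum fun j hj => hb j (mem_range.1 hj))

/-- Entries of `A ∗_w J`: the weighted row sums. -/
theorem wmul_onesArr_right_apply (w : S → ℝ) (A : S → S → ℂ) (s t : S) :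
    wmul w A onesArr s t = ∑ u, A s u * (w u : ℂ) := by
  simp [wmul, onesArr]

/-! ## §6b The envelope with entry-localised tails -/

set_option maxHeartbeats 400000 in
/-- **The envelope of the s-wave-dressed cascade with scale-dependent weights and entry-localised tails ((E2-v4)
`PairLadderStepAtV4` at every step ⇒ (B1-v2) `PairArrayAt`).**  Weights `w_n ≥ 0` per step (`W_n = Σ w_n`), a repulsive initial
s-wave value `U_0 ≥ 0` with its exact cascade `U_{n+1} = U_n / (1 + W_n U_n)`, arrays with the implicit ladder steps in structured
form `𝒞_{n+1} = 𝒞_n − 𝒞_{n+1} ∗_{w_n} 𝒞_n + (Δ_n + Δ_n ∗_{w_n} 𝒞_n)` (`n < N`), remainders with `|Δ_n(s,t)| ≤ a_n + d_n(s,t)`,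
`0 ≤ a_n`, `0 ≤ d_n(s,t) ≤ d̄`, `Σ_{j<N} d_j(s,t) ≤ δ` for every entry, and the smallness
`160·(esup 𝒟_0 + δ + d̄ + 2 Σ_{j<N} a_j)·Σ_{j<N} W_j ≤ 1` (`𝒟_n := 𝒞_n − U_n J`).  THEN for all `n ≤ N`: `0 ≤ U_n ≤ U_0` and
`esup (𝒞_n − U_n J) ≤ 8·(esup (𝒞_0 − U_0 J) + δ + d̄ + 2 Σ_{j<N} a_j)`. -/
theorem sWaveCascade_envelope_sector {w : ℕ → S → ℝ} (hw : ∀ n u, 0 ≤ w n u) {𝒞 Δ : ℕ → S → S → ℂ} {U : ℕ → ℝ} {N : ℕ}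
    (hU0 : 0 ≤ U 0) (hU : ∀ n, U (n + 1) = U n / (1 + (∑ u, w n u) * U n))
    (hstep : ∀ n < N, 𝒞 (n + 1) = 𝒞 n - wmul (w n) (𝒞 (n + 1)) (𝒞 n) + (Δ n + wmul (w n) (Δ n) (𝒞 n)))
    {a : ℕ → ℝ} {d : ℕ → S → S → ℝ} {δ dbar : ℝ} (ha : ∀ n, 0 ≤ a n) (hd0 : ∀ n s t, 0 ≤ d n s t)
    (hdbar : ∀ n < N, ∀ s t, d n s t ≤ dbar) (hdbar0 : 0 ≤ dbar) (hδ0 : 0 ≤ δ) (hδ : ∀ s t, ∑ j ∈ range N, d j s t ≤ δ)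
    (hΔ : ∀ n < N, ∀ s t, ‖Δ n s t‖ ≤ a n + d n s t)
    (hsmall : 160 * (esup (𝒞 0 - ((U 0 : ℝ) : ℂ) • onesArr) + δ + dbar + 2 * ∑ j ∈ range N, a j) *
      ∑ j ∈ range N, (∑ u, w j u) ≤ 1) :
    ∀ n ≤ N, (0 ≤ U n ∧ U n ≤ U 0) ∧
      esup (𝒞 n - ((U n : ℝ) : ℂ) • onesArr) ≤
        8 * (esup (𝒞 0 - ((U 0 : ℝ) : ℂ) • onesArr) + δ + dbar + 2 * ∑ j ∈ range N, a j) := by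
  -- the scalar cascade
  set Wn : ℕ → ℝ := fun n => ∑ u, w n u with hWn
  have hWn0 : ∀ n, 0 ≤ Wn n := fun n => sum_nonneg fun u _ => hw n u
  have hU' : ∀ n, U (n + 1) = U n / (1 + Wn n * 1 * U n) := fun n => by rw [hU n, mul_one]
  have hUn : ∀ n, 0 ≤ U n := sWave_nonneg (W := 1) zero_le_one hWn0 hU0 hU'
  have hUle : ∀ n, U n ≤ U 0 := sWave_le_init (W := 1) zero_le_one hWn0 hU0 hU'
  have hrel : ∀ n, U (n + 1) * (1 + Wn n * U n) = U n := fun n => by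
    have := sWave_relation (W := 1) zero_le_one hWn0 hU0 hU' n; rwa [mul_one] at this
  have hα'1 : ∀ n, Wn n * U (n + 1) ≤ 1 := fun n => by
    have := sWave_alpha_succ_le_one (W := 1) zero_le_one hWn0 hU0 hU' n; rwa [mul_one] at this
  -- the sizes
  set abar : ℝ := ∑ j ∈ range N, a j with habar
  have habar0 : 0 ≤ abar := sum_nonneg fun j _ => ha j
  have ha_le : ∀ n < N, a n ≤ abar := fun n hn =>
    single_le_sum (f := a) (fun j _ => ha j) (mem_range.2 hn)
  -- the arrays
  set 𝒟 : ℕ → S → S → ℂ := fun n => 𝒞 n - ((U n : ℝ) : ℂ) • onesArr with h𝒟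
  set E : ℕ → S → S → ℂ := fun n => Δ n + wmul (w n) (Δ n) (𝒟 n) - wmul (w n) (𝒟 (n + 1)) (𝒟 n) with hE
  set q : ℕ → ℝ := fun n => esup (wmul (w n) (Δ n) (𝒟 n)) + esup (wmul (w n) (𝒟 (n + 1)) (𝒟 n)) with hq
  have hq0 : ∀ n, 0 ≤ q n := fun n => add_nonneg (esup_nonneg _) (esup_nonneg _)
  set K : ℕ → S → S → ℂ := fun n => 𝒟 0 + ∑ j ∈ range n, E j with hK
  set kK : ℕ → ℝ := fun n => esup (𝒟 0) + δ + ∑ j ∈ range n, (a j + q j) with hkK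
  set k : ℕ → ℝ := fun n => kK n + (abar + dbar) with hk
  have hK_succ : ∀ n, K (n + 1) = K n + E n := fun n => by simp only [hK, sum_range_succ]; abel
  have hkK_succ : ∀ n, kK (n + 1) = kK n + (a n + q n) := fun n => by simp only [hkK, sum_range_succ]; ring
  have hk_succ : ∀ n, k (n + 1) = k n + (a n + q n) := fun n => by simp only [hk, hkK_succ]; ring
  have hkK0 : ∀ n, 0 ≤ kK n := fun n =>
    add_nonneg (add_nonneg (esup_nonneg _) hδ0) (sum_nonneg fun j _ => add_nonneg (ha j) (hq0 j))
  have hkKk : ∀ n, kK n ≤ k n := fun n => by simp only [hk]; linarith [habar0, hdbar0]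
  have hk0 : ∀ n, 0 ≤ k n := fun n => (hkK0 n).trans (hkKk n)
  have hk_mono : ∀ n, k n ≤ k (n + 1) := fun n => by rw [hk_succ]; linarith [ha n, hq0 n]
  -- uniform entry bound of the remainder
  have hΔsup : ∀ n < N, esup (Δ n) ≤ a n + dbar := fun n hn =>
    esup_le (fun s t => (hΔ n hn s t).trans (by linarith [hdbar n hn s t])) (by linarith [ha n])
  -- entrywise bound of the core
  have hEst : ∀ j < N, ∀ s t, ‖E j s t‖ ≤ (a j + q j) + d j s t := by
    intro j hj s t
    have h1 : ‖(Δ j + wmul (w j) (Δ j) (𝒟 j) - wmul (w j) (𝒟 (j + 1)) (𝒟 j)) s t‖ ≤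
        ‖Δ j s t‖ + ‖wmul (w j) (Δ j) (𝒟 j) s t‖ + ‖wmul (w j) (𝒟 (j + 1)) (𝒟 j) s t‖ := by
      simp only [Pi.add_apply, Pi.sub_apply]
      exact (norm_sub_le _ _).trans (add_le_add (norm_add_le _ _) le_rfl)
    have h2 := le_esup (wmul (w j) (Δ j) (𝒟 j)) s t
    have h3 := le_esup (wmul (w j) (𝒟 (j + 1)) (𝒟 j)) s t
    have h4 := hΔ j hj s t
    simp only [hE, hq]
    linarith
  have hKk : ∀ n ≤ N, ∀ s t, ‖K n s t‖ ≤ kK n := by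
    intro n hn s t
    have h1 : ‖K n s t‖ ≤ ‖𝒟 0 s t‖ + ‖(∑ j ∈ range n, E j) s t‖ := by
      simp only [hK, Pi.add_apply]; exact norm_add_le _ _
    have h2 := norm_sum_apply_le E n s t (b := fun j => (a j + q j) + d j s t)
      (fun j hj => hEst j (lt_of_lt_of_le hj hn) s t)
    have h3 : ∑ j ∈ range n, ((a j + q j) + d j s t) = (∑ j ∈ range n, (a j + q j)) + ∑ j ∈ range n, d j s t :=
      sum_add_distrib
    have h4 : ∑ j ∈ range n, d j s t ≤ δ :=
      (sum_le_sum_of_subset_of_nonneg (range_mono hn) fun j _ _ => hd0 j s t).trans (hδ s t)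
    have h5 := le_esup (𝒟 0) s t
    simp only [hkK]
    linarith
  -- the implicit step identity at every `n < N`, with the column injection separated
  have h𝒞dec : ∀ n, 𝒞 n = ((U n : ℝ) : ℂ) • onesArr + 𝒟 n := fun n => by simp only [h𝒟]; abel
  have hstar : ∀ n < N, 𝒟 (n + 1) + ((U n : ℝ) : ℂ) • wmul (w n) (𝒟 (n + 1)) onesArr =
      𝒟 n - ((U (n + 1) : ℝ) : ℂ) • wmul (w n) onesArr (𝒟 n) + (E n + ((U n : ℝ) : ℂ) • wmul (w n) (Δ n) onesArr) := by
    intro n hn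
    have h1 := step_decompose' (w n) (T := Δ n + wmul (w n) (Δ n) (𝒞 n)) (𝒟 := 𝒟 n) (𝒟' := 𝒟 (n + 1))
      (hstep n hn) (hrel n) rfl rfl
    rw [h1]
    congr 1
    have h2 : wmul (w n) (Δ n) (𝒞 n) = ((U n : ℝ) : ℂ) • wmul (w n) (Δ n) onesArr + wmul (w n) (Δ n) (𝒟 n) := by
      rw [h𝒞dec n, wmul_add_right, wmul_smul_right]
    rw [h2]
    simp only [hE]
    abel
  -- the row / column / scalar recursion
  set ρ : ℕ → S → ℂ := fun n t => ∑ u, (w n u : ℂ) * K n u t with hρ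
  set κ : ℕ → S → ℂ := fun n s => ∑ u, K (n + 1) s u * (w n u : ℂ) with hκ
  set κΔ : ℕ → S → ℂ := fun n s => ∑ u, Δ n s u * (w n u : ℂ) with hκΔ
  set F : ℕ → (S → ℂ) × (S → ℂ) × ℂ → (S → ℂ) × (S → ℂ) × ℂ := fun n X =>
    ( fun t => (((1 - U (n + 1) * Wn n : ℝ)) : ℂ) * X.1 t - ((U (n + 1) : ℝ) : ℂ) * ρ n t,
      fun s => (X.2.1 s - ((U n : ℝ) : ℂ) * κ n s + ((U n : ℝ) : ℂ) * κΔ n s) / (((1 + U n * Wn n : ℝ)) : ℂ),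
      (X.2.2 * (((1 - U (n + 1) * Wn n : ℝ)) : ℂ) - ((U (n + 1) : ℝ) : ℂ) * (∑ u, (w n u : ℂ) * X.2.1 u) -
        ((U n : ℝ) : ℂ) * (∑ u, ((((1 - U (n + 1) * Wn n : ℝ)) : ℂ) * X.1 u - ((U (n + 1) : ℝ) : ℂ) * ρ n u) * (w n u : ℂ))) /
        (((1 + U n * Wn n : ℝ)) : ℂ) ) with hF
  obtain ⟨X, hX0, hXs⟩ : ∃ X : ℕ → (S → ℂ) × (S → ℂ) × ℂ, X 0 = (0, 0, 0) ∧ ∀ n, X (n + 1) = F n (X n) :=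
    ⟨fun n => Nat.rec ((0 : S → ℂ), (0 : S → ℂ), (0 : ℂ)) F n, rfl, fun n => rfl⟩
  have hden : ∀ n, (((1 + U n * Wn n : ℝ)) : ℂ) ≠ 0 := fun n => by
    have : (0 : ℝ) < 1 + U n * Wn n := by have := mul_nonneg (hUn n) (hWn0 n); linarith
    exact_mod_cast this.ne'
  have eR : ∀ n t, (X (n + 1)).1 t =
      (((1 - U (n + 1) * Wn n : ℝ)) : ℂ) * (X n).1 t - ((U (n + 1) : ℝ) : ℂ) * ρ n t := fun n t => by rw [hXs n]
  have eC : ∀ n s, (X (n + 1)).2.1 s * (((1 + U n * Wn n : ℝ)) : ℂ) =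
      (X n).2.1 s - ((U n : ℝ) : ℂ) * κ n s + ((U n : ℝ) : ℂ) * κΔ n s :=
    fun n s => by rw [hXs n]; exact div_mul_cancel₀ _ (hden n)
  have eσ : ∀ n, (X (n + 1)).2.2 * (((1 + U n * Wn n : ℝ)) : ℂ) =
      (X n).2.2 * (((1 - U (n + 1) * Wn n : ℝ)) : ℂ) - ((U (n + 1) : ℝ) : ℂ) * (∑ u, (w n u : ℂ) * (X n).2.1 u) -
        ((U n : ℝ) : ℂ) * (∑ u, (X (n + 1)).1 u * (w n u : ℂ)) := fun n => by
    have h1 : (X (n + 1)).2.2 = (F n (X n)).2.2 := by rw [hXs n]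
    have h2 : ∀ u, (X (n + 1)).1 u = (F n (X n)).1 u := fun u => by rw [hXs n]
    rw [h1]
    simp only [hF]
    rw [div_mul_cancel₀ _ (hden n)]
    congr 1
    congr 1
    exact sum_congr rfl fun u _ => by rw [h2 u]
  -- MAIN INDUCTION: decomposition + bounds
  have main : ∀ n ≤ N, 𝒟 n = K n + (fun _ t => (X n).1 t) + (fun s _ => (X n).2.1 s) + (X n).2.2 • onesArr ∧
      (∀ t, ‖(X n).1 t‖ ≤ k n) ∧ (∀ s, ‖(X n).2.1 s‖ ≤ k n) ∧ ‖(X n).2.2‖ ≤ k n := by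
    intro n
    induction n with
    | zero =>
      intro _
      refine ⟨?_, fun t => ?_, fun s => ?_, ?_⟩
      · funext s t; simp [hK, hX0]
      · simp [hX0, hk0 0]
      · simp [hX0, hk0 0]
      · simp [hX0, hk0 0]
    | succ n ih =>
      intro hn
      have hn' : n < N := Nat.lt_of_succ_le hn
      obtain ⟨hdec, hR, hC, hσ⟩ := ih hn'.le
      have hWUn : 0 ≤ U n * Wn n := mul_nonneg (hUn n) (hWn0 n)
      have hα'0 : 0 ≤ U (n + 1) * Wn n := mul_nonneg (hUn (n + 1)) (hWn0 n)
      have hα'1' : U (n + 1) * Wn n ≤ 1 := by rw [mul_comm]; exact hα'1 n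
      -- (1) the decomposition at n+1: candidate and uniqueness
      set Xc : S → S → ℂ := K (n + 1) + (fun _ t => (X (n + 1)).1 t) + (fun s _ => (X (n + 1)).2.1 s) +
        (X (n + 1)).2.2 • onesArr with hXc
      have hcand : Xc + ((U n : ℝ) : ℂ) • wmul (w n) Xc onesArr =
          𝒟 n - ((U (n + 1) : ℝ) : ℂ) • wmul (w n) onesArr (𝒟 n) + (E n + ((U n : ℝ) : ℂ) • wmul (w n) (Δ n) onesArr) := by
        rw [hdec, wmul_onesArr_right_eq (w n) (Δ n)]
        funext s t
        simp only [hXc, Pi.add_apply, Pi.sub_apply, Pi.smul_apply, smul_eq_mul, wmul_decomp_onesArr, onesArr_wmul_decomp,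
          onesArr, mul_one, hK_succ]
        have e1 := eR n t
        have e2 := eC n s
        have e3 := eσ n
        have eκ : κ n s = ∑ u, K (n + 1) s u * (w n u : ℂ) := rfl
        have eρ : ρ n t = ∑ u, (w n u : ℂ) * K n u t := rfl
        have eκΔ : κΔ n s = ∑ u, Δ n s u * (w n u : ℂ) := rfl
        rw [hK_succ] at eκ
        simp only [Pi.add_apply] at eκ
        have eW : (∑ u, (w n u : ℂ)) = ((Wn n : ℝ) : ℂ) := by rw [hWn]; push_cast; rfl
        rw [eW]
        rw [eκ, eκΔ] at e2
        rw [eρ] at e1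
        push_cast at e1 e2 e3 ⊢
        linear_combination e1 + e2 + e3
      have hdiff : (𝒟 (n + 1) - Xc) + ((U n : ℝ) : ℂ) • wmul (w n) (𝒟 (n + 1) - Xc) onesArr = 0 := by
        rw [wmul_sub_left, smul_sub]
        have := hstar n hn'
        rw [← sub_eq_zero]
        have h2 := hcand
        calc 𝒟 (n + 1) - Xc + (((U n : ℝ) : ℂ) • wmul (w n) (𝒟 (n + 1)) onesArr - ((U n : ℝ) : ℂ) • wmul (w n) Xc onesArr) - 0
            = (𝒟 (n + 1) + ((U n : ℝ) : ℂ) • wmul (w n) (𝒟 (n + 1)) onesArr) -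
                (Xc + ((U n : ℝ) : ℂ) • wmul (w n) Xc onesArr) := by abel
          _ = 0 := by rw [this, h2, sub_self]
      have hdec' : 𝒟 (n + 1) = Xc := by
        have := eq_zero_of_add_smul_wmul_onesArr (hw n) (hUn n) hdiff
        exact sub_eq_zero.1 this
      -- (2) the bounds
      have hρb : ∀ t, ‖ρ n t‖ ≤ Wn n * kK n := fun t =>
        (norm_sum_mul_le' (hw n) (fun u => hKk n hn'.le u t)).trans le_rfl
      have hκb : ∀ s, ‖κ n s‖ ≤ Wn n * kK (n + 1) := fun s =>
        (norm_sum_mul_le (hw n) (fun u => hKk (n + 1) hn s u)).trans le_rfl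
      have hκΔb : ∀ s, ‖κΔ n s‖ ≤ Wn n * (a n + dbar) := fun s =>
        norm_sum_mul_le (hw n) (fun u => (hΔ n hn' s u).trans (by linarith [hdbar n hn' s u]))
      have hkn := hk_mono n
      have hkKn : kK n ≤ k n := hkKk n
      have hkK' : kK (n + 1) + (a n + dbar) ≤ k (n + 1) := by
        simp only [hk]; linarith [ha_le n hn']
      have hR' : ∀ t, ‖(X (n + 1)).1 t‖ ≤ k (n + 1) := by
        intro t
        rw [eR n t]
        refine (norm_sub_le _ _).trans ?_
        rw [norm_mul, norm_mul, Complex.norm_real, Complex.norm_real, Real.norm_eq_abs, Real.norm_eq_abs,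
          abs_of_nonneg (by linarith), abs_of_nonneg (hUn (n + 1))]
        have h1 : (1 - U (n + 1) * Wn n) * ‖(X n).1 t‖ ≤ (1 - U (n + 1) * Wn n) * k n :=
          mul_le_mul_of_nonneg_left (hR t) (by linarith)
        have h2 : U (n + 1) * ‖ρ n t‖ ≤ U (n + 1) * (Wn n * k n) :=
          mul_le_mul_of_nonneg_left ((hρb t).trans (mul_le_mul_of_nonneg_left hkKn (hWn0 n))) (hUn (n + 1))
        nlinarith
      have hC' : ∀ s, ‖(X (n + 1)).2.1 s‖ ≤ k (n + 1) := by
        intro s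
        have e2 := eC n s
        have hnorm : ‖(X (n + 1)).2.1 s‖ * (1 + U n * Wn n) =
            ‖(X n).2.1 s - ((U n : ℝ) : ℂ) * κ n s + ((U n : ℝ) : ℂ) * κΔ n s‖ := by
          rw [← e2, norm_mul, Complex.norm_real, Real.norm_eq_abs, abs_of_nonneg (by linarith)]
        have hb : ‖(X n).2.1 s - ((U n : ℝ) : ℂ) * κ n s + ((U n : ℝ) : ℂ) * κΔ n s‖ ≤
            k n + U n * Wn n * k (n + 1) := by
          refine (norm_add_le _ _).trans ?_
          refine (add_le_add (norm_sub_le _ _) le_rfl).trans ?_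
          rw [norm_mul, norm_mul, Complex.norm_real, Real.norm_eq_abs, abs_of_nonneg (hUn n)]
          have h1 := mul_le_mul_of_nonneg_left (hκb s) (hUn n)
          have h2 := mul_le_mul_of_nonneg_left (hκΔb s) (hUn n)
          have h3 : U n * (Wn n * kK (n + 1)) + U n * (Wn n * (a n + dbar)) ≤ U n * Wn n * k (n + 1) := by
            have := mul_le_mul_of_nonneg_left hkK' hWUn
            nlinarith
          linarith [hC s]
        have hpos : 0 < 1 + U n * Wn n := by linarith
        have h' : ‖(X (n + 1)).2.1 s‖ * (1 + U n * Wn n) ≤ k (n + 1) * (1 + U n * Wn n) := by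
          rw [hnorm]; nlinarith
        exact le_of_mul_le_mul_right h' hpos
      have hσ' : ‖(X (n + 1)).2.2‖ ≤ k (n + 1) := by
        have e3 := eσ n
        have hnorm : ‖(X (n + 1)).2.2‖ * (1 + U n * Wn n) =
            ‖(X n).2.2 * (((1 - U (n + 1) * Wn n : ℝ)) : ℂ) - ((U (n + 1) : ℝ) : ℂ) * (∑ u, (w n u : ℂ) * (X n).2.1 u) -
              ((U n : ℝ) : ℂ) * (∑ u, (X (n + 1)).1 u * (w n u : ℂ))‖ := by
          rw [← e3, norm_mul, Complex.norm_real, Real.norm_eq_abs, abs_of_nonneg (by linarith)]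
        have hC_avg : ‖∑ u, (w n u : ℂ) * (X n).2.1 u‖ ≤ Wn n * k n := norm_sum_mul_le' (hw n) hC
        have hR_avg : ‖∑ u, (X (n + 1)).1 u * (w n u : ℂ)‖ ≤ Wn n * k (n + 1) := norm_sum_mul_le (hw n) hR'
        have hb : ‖(X n).2.2 * (((1 - U (n + 1) * Wn n : ℝ)) : ℂ) - ((U (n + 1) : ℝ) : ℂ) * (∑ u, (w n u : ℂ) * (X n).2.1 u) -
              ((U n : ℝ) : ℂ) * (∑ u, (X (n + 1)).1 u * (w n u : ℂ))‖ ≤ k (n + 1) + U n * Wn n * k (n + 1) := by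
          refine (norm_sub_le _ _).trans ?_
          refine (add_le_add (norm_sub_le _ _) le_rfl).trans ?_
          rw [norm_mul, norm_mul, norm_mul, Complex.norm_real, Complex.norm_real, Complex.norm_real, Real.norm_eq_abs,
            Real.norm_eq_abs, Real.norm_eq_abs, abs_of_nonneg (by linarith : (0:ℝ) ≤ 1 - U (n + 1) * Wn n),
            abs_of_nonneg (hUn (n + 1)), abs_of_nonneg (hUn n)]
          have h1 : ‖(X n).2.2‖ * (1 - U (n + 1) * Wn n) ≤ k n * (1 - U (n + 1) * Wn n) :=
            mul_le_mul_of_nonneg_right hσ (by linarith)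
          have h2 : U (n + 1) * ‖∑ u, (w n u : ℂ) * (X n).2.1 u‖ ≤ U (n + 1) * (Wn n * k n) :=
            mul_le_mul_of_nonneg_left hC_avg (hUn (n + 1))
          have h3 : U n * ‖∑ u, (X (n + 1)).1 u * (w n u : ℂ)‖ ≤ U n * (Wn n * k (n + 1)) :=
            mul_le_mul_of_nonneg_left hR_avg (hUn n)
          nlinarith
        have hpos : 0 < 1 + U n * Wn n := by linarith
        have h' : ‖(X (n + 1)).2.2‖ * (1 + U n * Wn n) ≤ k (n + 1) * (1 + U n * Wn n) := by rw [hnorm]; linarith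
        exact le_of_mul_le_mul_right h' hpos
      exact ⟨by rw [hdec'], hR', hC', hσ'⟩
  -- `esup 𝒟 n ≤ 4 k n`
  have he : ∀ n ≤ N, esup (𝒟 n) ≤ 4 * k n := by
    intro n hn
    obtain ⟨hdec, hR, hC, hσ⟩ := main n hn
    refine esup_le (fun s t => ?_) (by linarith [hk0 n])
    rw [hdec]
    simp only [Pi.add_apply, Pi.smul_apply, smul_eq_mul, onesArr, mul_one]
    have h1 := hKk n hn s t
    calc ‖K n s t + (X n).1 t + (X n).2.1 s + (X n).2.2‖
        ≤ ‖K n s t‖ + ‖(X n).1 t‖ + ‖(X n).2.1 s‖ + ‖(X n).2.2‖ := by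
          refine (norm_add_le _ _).trans (add_le_add ((norm_add_le _ _).trans (add_le_add (norm_add_le _ _) le_rfl)) le_rfl)
      _ ≤ 4 * k n := by linarith [hkKk n, hR t, hC s]
  -- Gronwall on `k`
  have hkstep : ∀ n < N, k (n + 1) * (1 - 20 * Wn n * k n) ≤ k n + a n := by
    intro n hn
    have hadk : a n + dbar ≤ k n := by
      simp only [hk]; linarith [ha_le n hn, hkK0 n]
    have h1 : esup (wmul (w n) (Δ n) (𝒟 n)) ≤ (a n + dbar) * Wn n * (4 * k n) :=
      (esup_wmul_le (w n) (hw n) (Δ n) (𝒟 n)).trans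
        (mul_le_mul (mul_le_mul_of_nonneg_right (hΔsup n hn) (hWn0 n)) (he n hn.le) (esup_nonneg _)
          (mul_nonneg (by linarith [ha n]) (hWn0 n)))
    have h2 : esup (wmul (w n) (𝒟 (n + 1)) (𝒟 n)) ≤ (4 * k (n + 1)) * Wn n * (4 * k n) :=
      (esup_wmul_le (w n) (hw n) (𝒟 (n + 1)) (𝒟 n)).trans
        (mul_le_mul (mul_le_mul_of_nonneg_right (he (n + 1) (Nat.succ_le_of_lt hn)) (hWn0 n)) (he n hn.le) (esup_nonneg _)
          (mul_nonneg (by linarith [hk0 (n + 1)]) (hWn0 n)))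
    have h3 : (a n + dbar) * Wn n * (4 * k n) ≤ k (n + 1) * Wn n * (4 * k n) :=
      mul_le_mul_of_nonneg_right (mul_le_mul_of_nonneg_right (hadk.trans (hk_mono n)) (hWn0 n))
        (by linarith [hk0 n])
    have h4 : q n ≤ 20 * Wn n * k (n + 1) * k n := by
      simp only [hq]; nlinarith [h1, h2, h3]
    calc k (n + 1) * (1 - 20 * Wn n * k n) = k (n + 1) - 20 * Wn n * k (n + 1) * k n := by ring
      _ = k n + (a n + q n) - 20 * Wn n * k (n + 1) * k n := by rw [hk_succ n]
      _ ≤ k n + a n := by linarith [h4]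
  have hk0eq : k 0 = esup (𝒟 0) + δ + dbar + abar := by simp [hk, hkK]; ring
  have hsmall' : 8 * 20 * (k 0 + ∑ j ∈ range N, a j) * ∑ j ∈ range N, Wn j ≤ 1 := by
    have : k 0 + ∑ j ∈ range N, a j = esup (𝒟 0) + δ + dbar + 2 * ∑ j ∈ range N, a j := by
      rw [hk0eq, habar]; ring
    rw [this]
    have h160 : (8 : ℝ) * 20 = 160 := by norm_num
    rw [h160]
    exact hsmall
  have hG := implicit_gronwall (d := k) (t := a) (b := Wn) (K := 20) (by norm_num) hk0 ha hWn0
    (fun n hn => by simpa [mul_assoc, mul_comm, mul_left_comm] using hkstep n hn) hsmall'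
  intro n hn
  refine ⟨⟨hUn n, hUle n⟩, ?_⟩
  calc esup (𝒟 n) ≤ 4 * k n := he n hn
    _ ≤ 4 * (2 * (k 0 + ∑ j ∈ range N, a j)) := by linarith [hG n hn]
    _ = 8 * (esup (𝒟 0) + δ + dbar + 2 * ∑ j ∈ range N, a j) := by rw [hk0eq, habar]; ring

end Summit.HubbardSuperconductivity.HubbardSuperconductivity.Theorems.SWaveCascade

end
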